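import Summits.QuantumFields.BalabanUV.Beta.GAN24.T2RecSourceRowsUndressed
import Summits.QuantumFields.BalabanUV.Beta.GAN24.T2RecOfUnitSplit
import Summits.QuantumFields.BalabanUV.Beta.GAN24.TransportRowsRoot
import Summits.QuantumFields.BalabanUV.Beta.GAN24.SrecAtSlotRowsFinal
import Summits.QuantumFields.BalabanUV.Beta.SecondOrderTableLawEnd

/-!
# `BalabanUV.Beta.GAN24.T2UndressedCombShapeEnd` — binder row G-an2-4 ∕ (CONV-C), CT-W route (R-DEV) (the OWNER gan24-p1 g23's RULING R-gan24p1-g23-1,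
# journal `CLAIMS.log` l.37889), **ROW (U): «T2Shape» OF THE UNDRESSED-KERNEL COMB-SLOT TOWER — the reference tower of the deviation `D_j := T̃_j − T_j` —
# FROM ITS SOURCE ZERO-MODE ROW (F2a-comb) ALONE**, every in-block root, pin `cE = Lc⁴`, `|cE₂| ≤ Lc⁸`, every `cVH cΛ cB Tc`, every off-diagonal `LocStencil₂` border

NOT IN PRINT; OUR PROOF ATTEMPT (G-an2-4 formalisation swarm, leaf prover `b2b-balaban-gan24-formalise-leaf-04` gen 58, crux team (2); journal INTENT 1 «(U)-ROWS OF THE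
(R-DEV) REFERENCE TOWER» l.37924; names PROVISIONAL — the OWNER may rename ∕ re-cut).  HONEST FRAMING (cell contract, verbatim): «discharging `BetaPertH` makes Bałaban's
UV stability UNCONDITIONAL — a real constructive-QFT result; it is NOT the continuum limit and NOT the Clay problem.»  HONEST DEPENDENCY (verbatim): «continuum YM on T⁴ ⇐
BetaPertH ∧ nine spine estimates (0/9 proved); BetaPertH ⇐ (D1) ∧ (D4) ∧ CAP+tail; G-an2-4 gates asym, D1 and NE2/3/4.»

WHAT ([folklore] composition BY NAME; 0 `def`, 0 cited facts, 0 `def … : Prop`, 0 sorry).  The reference tower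
`T_j := unitS₂_j (T2RecOf 3 Lc (fun j ↦ KInvStep Lc j) (SpureRecAt 3 Lc ρ cE cVH cΛ) (M1At 3 Lc ρ cΛ) cE₂ cB Tc vh₂S (mixFFAt ρ Lc) j)` has the UNDRESSED unit resolvents in
its kernel legs and the COMB slots; its transport IS road W3's transport OF RECORD, so road W3's END #1 `WSlotT2OfPieces.shape_of_rows` applies DIRECTLY (no hybrid split,
no contact remainder): (F1) `hsplit` = gan24-p2's `T2RecOfUnitSplit.unitS₂_T2RecOf_eq_transport_add_sum_of_letters` at `G := fun j ↦ KInvStep Lc j` (letters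
`OneStepKernelFamily.decays_KInvStep`, an2's `locStencil_SpureRecAt` ∕ `vertexFamily_M1At`, an1's `hmix_an1`); (F3) `hTmarg` ∕ `hTirr` = `TransportRows.transport_rows_three_symZ`
∘ road P1's `KSlotAssembly.convCKWall_holds` under the pin (`mom := 0` — vacuous at `d = 3`, `TransportIrrelevant.hTirr_three_slot`); (F4a) `hb` = this lineage's twin
`T2RecSourceRowsUndressed.source_rows_three_of_srecAt_rows` ∘ the OWNER's `SrecAtSlotRowsFinal.exists_hS_hSall_SrecAt_three` (§0: HYPOTHESIS-FREE at the pin); (F5)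
`h0` = member 0 (`unitS₂_step_zero`, `T2RecOf_zero_level`, an3's `biLoc_wilsonW₂`, the border shape).  WHAT STAYS A LETTER: (F2a-comb) `hZ` — joint `Lc`-covariance ∧
bond-symmetrised field–field zero mode ZERO of every source `b_i` of THIS tower (road W3's `ZfreeSym` currency; W3's plug `WSlotSourceZeroModeHolds.zfree_bracket_an1` is
Stage-B-specific — `Spure`∕`M1` — so the comb-slot version is a separate mechanism piece over an2's `WardLocusRecursive*`; the ruling's (N0) reports it TRUE numerically at
`m = 0`, D = 2, and the OWNER's R-gan24p1-g23-4 ∕ R4b (journal l.38256 ∕ l.38311; kits j144442 ∕ j144591, D = 2, Bc = 1) at `m = 1` —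
`Z(b^B_1) = 2.5e-6` resp. `−7.9e-7` on scale `4e8`; float64, decides nothing in the kernel; `hZ` stays a BINDER here and no value of it is asserted).  RULING
R-gan24p1-g23-3 (v) (l.38256): «UNCONDITIONAL work continues and is WANTED: (U) rows (leaf-04 (A)(B))» — (A) = `T2RecSourceRowsUndressed` p312377 ✓, (B) = this file
(typed gen 58, filed gen 59).  §0 `source_rows_three_holds`; §1 `locStencil₂_unitS₂_T2RecOf_zero` (generic `d`); §2 **`t2Shape_undressedComb_three_of_F2a`** (any root, generic border);
§3 **`t2Shape_undressedComb_literal_of_F2a`** (centre root, the D1 pins, `Tc := (8N²)⁻¹ • wsym22 N`, `vh₂SAn1 Lc`, odd `Lc`).  Row (U) is ONE of the four rows (U)(Z′)(G′)(F3ᴱ-irr)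
of the OWNER's (R-DEV) END; «T2Drift» of the reference tower (road W3's END #2 pattern) is NOT here.  Discharges NOTHING of «T2Shape»(E) ∕ «T2Drift» ∕ (hW, hWall) of the
DRESSED family; NEVER «G-an2-4 closed» as (CONV-C); NOT D1, NOT `BetaPertH`, NOT continuum, NOT Clay; not in print — our bookkeeping.  2026-08-22.
-/

noncomputable section

open Finset
open scoped BigOperators
open Literature.MathematicalPhysics.QuantumFieldTheory
open Literature.MathematicalPhysics.QuantumFieldTheory.Balaban1983to89
open Literature.MathematicalPhysics.QuantumFieldTheory.Balaban1983to89.Beta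
open ExpKernelCalculus (MKer Decays shiftK)
open OneStepResolventKernel (Fib LocStencil)
open OneStepKernelFamily (KInvStep decays_KInvStep)
open AffineAveraging (box toSite)
open AveragingContoursRooted (ctrOff ctrOff_mem_box)
open AveragingMixedJetTables (mixFFAt)
open WilsonVertex2Sym (wsym22)
open SecondOrderResponse (W2SymOfK)
open BalabanCompositeJets (LocStencil₂)
open BalabanStepJetsSucc (mmRead)
open BalabanStepW2 (K3OfK M2Of locStencil₂_smul' locStencil₂_add')
open WilsonBiStencil (wilsonW₂ wBound₂ biLoc_wilsonW₂)
open Summit.QuantumFields.BalabanUV.Beta.HessKerDressedUnits (unitK unitS)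
open Summit.QuantumFields.BalabanUV.Beta.SecondOrderUnits (unitM unitS₂ unitM₂)
open Summit.QuantumFields.BalabanUV.Beta.SpineRooted (T2RecOf SpureRecAt M1At locStencil_SpureRecAt vertexFamily_M1At T2RecOf_zero_level)
open Summit.QuantumFields.BalabanUV.Beta.WardLocusRecursive (SrecAt)
open Summit.QuantumFields.BalabanUV.Beta.MixedJetTablesPlug (hmix_an1)
open Summit.QuantumFields.BalabanUV.Beta.SecondOrderSocketIdentification (vh₂SAn1 vh₂SAn1_inl_inl vh₂SAn1_inr_inr)
open Summit.QuantumFields.BalabanUV.Beta.SecondOrderTableLawEnd (locStencil₂_vh₂SAn1)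
open Summit.QuantumFields.BalabanUV.Beta.GAN24.CombesThomas (sfStep smStep)
open Summit.QuantumFields.BalabanUV.Beta.GAN24.T2RecursionAffine (lin4)
open Summit.QuantumFields.BalabanUV.Beta.GAN24.AffineUnroll (transport)
open Summit.QuantumFields.BalabanUV.Beta.GAN24.Push4Iter (BiTab)
open Summit.QuantumFields.BalabanUV.Beta.GAN24.BiStencilZeroMode (zmode)
open Summit.QuantumFields.BalabanUV.Beta.GAN24.T2SlotUnits (unitS₂_step_zero)
open Summit.QuantumFields.BalabanUV.Beta.GAN24.TransportRows (inv_natCast_nonneg inv_natCast_lt_one transport_rows_three_symZ)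
open Summit.QuantumFields.BalabanUV.Beta.GAN24.KSlotAssembly (convCKWall_holds)
open Summit.QuantumFields.BalabanUV.Beta.GAN24.WSlotT2OfPieces (shape_of_rows)
open Summit.QuantumFields.BalabanUV.Beta.GAN24.T2RecOfUnitSplit (unitS₂_T2RecOf_eq_transport_add_sum_of_letters)
open Summit.QuantumFields.BalabanUV.Beta.GAN24.T2RecSourceRowsUndressed (source_rows_three_of_srecAt_rows)
open Summit.QuantumFields.BalabanUV.Beta.GAN24.SrecAtSlotRowsFinal (exists_hS_hSall_SrecAt_three)

namespace Summit.QuantumFields.BalabanUV.Beta.GAN24.T2UndressedCombShapeEnd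

variable {d : ℕ} {Lc : ℕ} [NeZero Lc]

/-! ## §1 (F5) Member `0` of the slotted tower in units (generic `d`, any slots, any border with a `LocStencil₂` shape) -/

omit [NeZero Lc] in
/-- [folklore] **MEMBER `0` OF an2's SLOTTED TOWER `T2RecOf` IN UNITS IS A `LocStencil₂` FAMILY AT ANY RATE `δ ≥ 0` carried by the border's shape**
(`unitS₂_step_zero`, `T2RecOf_zero_level`, an3's `biLoc_wilsonW₂`; constant `|cE₂|·wBound₂·e^{8δ} + |cB|·CB`). -/
theorem locStencil₂_unitS₂_T2RecOf_zero (G : ℕ → MKer (d + 1) (Fib d)) (S M : ℕ → Fin (d + 1) → (Fin (d + 1) → ℤ) → MKer (d + 1) (Fib d)) (cE₂ cB : ℝ)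
    (Tc : Fin 4 → Fin 4 → Fin 4 → Fin 4 → ℝ) {vh₂S mixFF : BiTab d} {CB δ : ℝ} (hδ : 0 ≤ δ) (hB : LocStencil₂ vh₂S CB δ) :
    LocStencil₂ (unitS₂ (sfStep Lc 0) (smStep d Lc 0) (T2RecOf d Lc G S M cE₂ cB Tc vh₂S mixFF 0))
      (|cE₂| * (wBound₂ d Tc * Real.exp (8 * δ)) + |cB| * CB) δ := by
  rw [unitS₂_step_zero, T2RecOf_zero_level]
  have hWil : LocStencil₂ (wilsonW₂ d Tc) (wBound₂ d Tc * Real.exp (8 * δ)) δ := fun κ u κ' u' => biLoc_wilsonW₂ Tc hδ κ u κ' u'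
  exact locStencil₂_add' (locStencil₂_smul' cE₂ hWil) (locStencil₂_smul' cB hB)

section Three

variable {Lc : ℕ} [NeZero Lc] {r : Fin (3 + 1) → ℕ}

/-! ## §0 (`d = 3`, pin `cE = Lc⁴`) The reference tower's source rows, HYPOTHESIS-FREE (twin (A) ∘ the OWNER's Final) -/

/-- NOT IN PRINT; OUR PROOF ATTEMPT ([folklore] composition: `T2RecSourceRowsUndressed.source_rows_three_of_srecAt_rows` ∘ `SrecAtSlotRowsFinal.exists_hS_hSall_SrecAt_three`).
**BOTH SOURCE ROWS (F4a `LocStencil₂`, F4b Cauchy) OF THE UNDRESSED-KERNEL COMB-SLOT TOWER AT THE PIN `cE = Lc⁴`** — every `cVH cΛ cE₂ cB`, every in-block root, every border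
with a `LocStencil₂` shape; NO row binder left. -/
theorem source_rows_three_holds (hLc : 2 ≤ Lc) {cE : ℝ} (hcE : cE = (Lc : ℝ) ^ (3 + 1)) (cVH cΛ cE₂ cB : ℝ) {vh₂S : BiTab 3} {CB δB : ℝ}
    (hB : LocStencil₂ vh₂S CB δB) (hδB : 0 < δB) (hr : r ∈ box (3 + 1) Lc) :
    (∃ Cb δb : ℝ, 0 < δb ∧ ∀ j, LocStencil₂ (fun κ u κ' u' => (cE₂ * (Lc : ℝ) ^ (2 * (3 + 1))) •
              mmRead Lc (K3OfK (unitK (sfStep Lc j) (smStep 3 Lc j) (KInvStep (d := 3) Lc j)) Lc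
              (unitS (sfStep Lc j) (smStep 3 Lc j) (SpureRecAt 3 Lc (toSite r) cE cVH cΛ j)) (unitM (sfStep Lc j) (smStep 3 Lc j) (M1At 3 Lc (toSite r) cΛ j))
              (W2SymOfK (unitK (sfStep Lc j) (smStep 3 Lc j) (KInvStep (d := 3) Lc j)) Lc
                (unitS (sfStep Lc j) (smStep 3 Lc j) (SpureRecAt 3 Lc (toSite r) cE cVH cΛ j)) (unitM (sfStep Lc j) (smStep 3 Lc j) (M1At 3 Lc (toSite r) cΛ j)) 0
                (unitM₂ (sfStep Lc j) (smStep 3 Lc j) (M2Of 3 Lc (mixFFAt (toSite r) Lc) j))) κ u κ' u') + cB • vh₂S κ u κ' u') Cb δb) ∧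
    (∃ cb θb δb : ℝ, 0 ≤ cb ∧ 0 ≤ θb ∧ θb < 1 ∧ 0 < δb ∧ ∀ k j, LocStencil₂ (fun κ u κ' u' =>
      ((cE₂ * (Lc : ℝ) ^ (2 * (3 + 1))) •
              mmRead Lc (K3OfK (unitK (sfStep Lc (k + j)) (smStep 3 Lc (k + j)) (KInvStep (d := 3) Lc (k + j))) Lc
              (unitS (sfStep Lc (k + j)) (smStep 3 Lc (k + j)) (SpureRecAt 3 Lc (toSite r) cE cVH cΛ (k + j))) (unitM (sfStep Lc (k + j)) (smStep 3 Lc (k + j)) (M1At 3 Lc (toSite r) cΛ (k + j)))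
              (W2SymOfK (unitK (sfStep Lc (k + j)) (smStep 3 Lc (k + j)) (KInvStep (d := 3) Lc (k + j))) Lc
                (unitS (sfStep Lc (k + j)) (smStep 3 Lc (k + j)) (SpureRecAt 3 Lc (toSite r) cE cVH cΛ (k + j))) (unitM (sfStep Lc (k + j)) (smStep 3 Lc (k + j)) (M1At 3 Lc (toSite r) cΛ (k + j))) 0
                (unitM₂ (sfStep Lc (k + j)) (smStep 3 Lc (k + j)) (M2Of 3 Lc (mixFFAt (toSite r) Lc) (k + j)))) κ u κ' u') + cB • vh₂S κ u κ' u') -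
      ((cE₂ * (Lc : ℝ) ^ (2 * (3 + 1))) •
              mmRead Lc (K3OfK (unitK (sfStep Lc k) (smStep 3 Lc k) (KInvStep (d := 3) Lc k)) Lc
              (unitS (sfStep Lc k) (smStep 3 Lc k) (SpureRecAt 3 Lc (toSite r) cE cVH cΛ k)) (unitM (sfStep Lc k) (smStep 3 Lc k) (M1At 3 Lc (toSite r) cΛ k))
              (W2SymOfK (unitK (sfStep Lc k) (smStep 3 Lc k) (KInvStep (d := 3) Lc k)) Lc
                (unitS (sfStep Lc k) (smStep 3 Lc k) (SpureRecAt 3 Lc (toSite r) cE cVH cΛ k)) (unitM (sfStep Lc k) (smStep 3 Lc k) (M1At 3 Lc (toSite r) cΛ k)) 0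
                (unitM₂ (sfStep Lc k) (smStep 3 Lc k) (M2Of 3 Lc (mixFFAt (toSite r) Lc) k))) κ u κ' u') + cB • vh₂S κ u κ' u')) (cb * θb ^ k) δb) := by
  obtain ⟨Cs, cS, θS, δS, hθS0, hθS1, hδS, hrows⟩ := exists_hS_hSall_SrecAt_three (Lc := Lc) hLc hcE cVH cΛ
  obtain ⟨hS, hSall⟩ := hrows r hr
  exact source_rows_three_of_srecAt_rows hLc hr cE cVH cΛ cE₂ cB hB hδB hS hSall hδS hθS0 hθS1

/-! ## §2 ROW (U) modulo F2a-comb, any in-block root -/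

/-- NOT IN PRINT; OUR PROOF ATTEMPT — ROW (U) OF THE (R-DEV) END ([folklore] composition BY NAME; ONE letter).  **«T2Shape» OF THE UNDRESSED-KERNEL COMB-SLOT TOWER**
(`2 ≤ Lc`, in-block root `r`, pin `cE = Lc⁴`, `|cE₂| ≤ Lc⁸`, every `cVH cΛ cB Tc`, OFF-DIAGONAL border `vh₂S` with a `LocStencil₂` shape): if every source `b_i` of this tower is
jointly `Lc`-covariant with bond-symmetrised field–field zero mode ZERO (`hZ`, F2a-comb — the analogue of road W3's `WSlotSourceZeroModeHolds.zfree_bracket_an1` for the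
COMB slot `SpureRecAt`, OPEN), then `∃ C₂ δ₂, 0 < δ₂ ∧ ∀ j, LocStencil₂ (unitS₂_j (T2RecOf 3 Lc (KInvStep Lc ·) (SpureRecAt 3 Lc (toSite r) cE cVH cΛ) (M1At 3 Lc (toSite r) cΛ) cE₂ cB Tc
vh₂S (mixFFAt (toSite r) Lc) j)) C₂ δ₂`.  Road W3's END #1 DIRECTLY: rows (F1)(F3)(F4a)(F5) discharged inside as in the header; constant `C_T·C₀ + C_T′·C_b·(1 − Lc⁻¹)⁻¹` at
the rate `δ_T` of `transport_rows_three_symZ`. -/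
theorem t2Shape_undressedComb_three_of_F2a (hLc : 2 ≤ Lc) (hr : r ∈ box (3 + 1) Lc) {cE : ℝ} (hcE : cE = (Lc : ℝ) ^ (3 + 1)) (cVH cΛ cE₂ cB : ℝ)
    (Tc : Fin 4 → Fin 4 → Fin 4 → Fin 4 → ℝ) {vh₂S : BiTab 3}
    (hBff : ∀ κ u κ' u' x z (α β : Fin (3 + 1)), vh₂S κ u κ' u' x z (Sum.inl α) (Sum.inl β) = 0)
    (hBmm : ∀ κ u κ' u' x z (μ ν : Fin (3 + 1)), vh₂S κ u κ' u' x z (Sum.inr μ) (Sum.inr ν) = 0)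
    {CB δB : ℝ} (hB : LocStencil₂ vh₂S CB δB) (hδB : 0 < δB) (hpin : |cE₂| ≤ (Lc : ℝ) ^ (2 * (3 + 1)))
    (hZ : ∀ i : ℕ,
      (∀ κ u κ' u' t,
          (cE₂ * (Lc : ℝ) ^ (2 * (3 + 1))) •
              mmRead Lc (K3OfK (unitK (sfStep Lc i) (smStep 3 Lc i) (KInvStep (d := 3) Lc i)) Lc
              (unitS (sfStep Lc i) (smStep 3 Lc i) (SpureRecAt 3 Lc (toSite r) cE cVH cΛ i)) (unitM (sfStep Lc i) (smStep 3 Lc i) (M1At 3 Lc (toSite r) cΛ i))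
              (W2SymOfK (unitK (sfStep Lc i) (smStep 3 Lc i) (KInvStep (d := 3) Lc i)) Lc
                (unitS (sfStep Lc i) (smStep 3 Lc i) (SpureRecAt 3 Lc (toSite r) cE cVH cΛ i)) (unitM (sfStep Lc i) (smStep 3 Lc i) (M1At 3 Lc (toSite r) cΛ i)) 0
                (unitM₂ (sfStep Lc i) (smStep 3 Lc i) (M2Of 3 Lc (mixFFAt (toSite r) Lc) i))) κ (u + (Lc : ℤ) • t) κ' (u' + (Lc : ℤ) • t)) + cB • vh₂S κ (u + (Lc : ℤ) • t) κ' (u' + (Lc : ℤ) • t) =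
        shiftK (-((Lc : ℤ) • t)) ((cE₂ * (Lc : ℝ) ^ (2 * (3 + 1))) •
              mmRead Lc (K3OfK (unitK (sfStep Lc i) (smStep 3 Lc i) (KInvStep (d := 3) Lc i)) Lc
              (unitS (sfStep Lc i) (smStep 3 Lc i) (SpureRecAt 3 Lc (toSite r) cE cVH cΛ i)) (unitM (sfStep Lc i) (smStep 3 Lc i) (M1At 3 Lc (toSite r) cΛ i))
              (W2SymOfK (unitK (sfStep Lc i) (smStep 3 Lc i) (KInvStep (d := 3) Lc i)) Lc
                (unitS (sfStep Lc i) (smStep 3 Lc i) (SpureRecAt 3 Lc (toSite r) cE cVH cΛ i)) (unitM (sfStep Lc i) (smStep 3 Lc i) (M1At 3 Lc (toSite r) cΛ i)) 0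
                (unitM₂ (sfStep Lc i) (smStep 3 Lc i) (M2Of 3 Lc (mixFFAt (toSite r) Lc) i))) κ u κ' u') + cB • vh₂S κ u κ' u')) ∧
      (∀ κ κ' κ₁ κ₂,
        zmode Lc (fun κ u κ' u' => (cE₂ * (Lc : ℝ) ^ (2 * (3 + 1))) •
              mmRead Lc (K3OfK (unitK (sfStep Lc i) (smStep 3 Lc i) (KInvStep (d := 3) Lc i)) Lc
              (unitS (sfStep Lc i) (smStep 3 Lc i) (SpureRecAt 3 Lc (toSite r) cE cVH cΛ i)) (unitM (sfStep Lc i) (smStep 3 Lc i) (M1At 3 Lc (toSite r) cΛ i))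
              (W2SymOfK (unitK (sfStep Lc i) (smStep 3 Lc i) (KInvStep (d := 3) Lc i)) Lc
                (unitS (sfStep Lc i) (smStep 3 Lc i) (SpureRecAt 3 Lc (toSite r) cE cVH cΛ i)) (unitM (sfStep Lc i) (smStep 3 Lc i) (M1At 3 Lc (toSite r) cΛ i)) 0
                (unitM₂ (sfStep Lc i) (smStep 3 Lc i) (M2Of 3 Lc (mixFFAt (toSite r) Lc) i))) κ u κ' u') + cB • vh₂S κ u κ' u') κ κ' (Sum.inl κ₁) (Sum.inl κ₂) +
        zmode Lc (fun κ u κ' u' => (cE₂ * (Lc : ℝ) ^ (2 * (3 + 1))) •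
              mmRead Lc (K3OfK (unitK (sfStep Lc i) (smStep 3 Lc i) (KInvStep (d := 3) Lc i)) Lc
              (unitS (sfStep Lc i) (smStep 3 Lc i) (SpureRecAt 3 Lc (toSite r) cE cVH cΛ i)) (unitM (sfStep Lc i) (smStep 3 Lc i) (M1At 3 Lc (toSite r) cΛ i))
              (W2SymOfK (unitK (sfStep Lc i) (smStep 3 Lc i) (KInvStep (d := 3) Lc i)) Lc
                (unitS (sfStep Lc i) (smStep 3 Lc i) (SpureRecAt 3 Lc (toSite r) cE cVH cΛ i)) (unitM (sfStep Lc i) (smStep 3 Lc i) (M1At 3 Lc (toSite r) cΛ i)) 0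
                (unitM₂ (sfStep Lc i) (smStep 3 Lc i) (M2Of 3 Lc (mixFFAt (toSite r) Lc) i))) κ u κ' u') + cB • vh₂S κ u κ' u') κ' κ (Sum.inl κ₁) (Sum.inl κ₂) = 0))
    :
    ∃ C₂ δ₂ : ℝ, 0 < δ₂ ∧ ∀ j, LocStencil₂ (unitS₂ (sfStep Lc j) (smStep 3 Lc j) (T2RecOf 3 Lc (fun j => KInvStep (d := 3) Lc j) (SpureRecAt 3 Lc (toSite r) cE cVH cΛ) (M1At 3 Lc (toSite r) cΛ) cE₂ cB Tc vh₂S (mixFFAt (toSite r) Lc) j)) C₂ δ₂ := by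
  have hLc1 : 1 ≤ Lc := by omega
  -- (F4a) at this root, hypothesis-free (§0)
  obtain ⟨⟨Cb, δb, hδb, hbrow⟩, -⟩ := source_rows_three_holds (r := r) hLc hcE cVH cΛ cE₂ cB hB hδB hr
  have hCb : 0 ≤ Cb := (hbrow 0).nonneg
  -- common INPUT rate of (F4a) and the border; (F5) member `0` there
  have hδin : 0 < min δb δB := lt_min hδb hδB
  have h0 := locStencil₂_unitS₂_T2RecOf_zero (Lc := Lc) (fun j => KInvStep (d := 3) Lc j) (SpureRecAt 3 Lc (toSite r) cE cVH cΛ)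
    (M1At 3 Lc (toSite r) cΛ) cE₂ cB Tc (mixFF := mixFFAt (toSite r) Lc) hδin.le (hB.mono (min_le_right _ _))
  -- (F3) road W3's transport rows of record under the pin, `mom := 0`
  obtain ⟨CK, δK, cK, θK, hδK, -, -, hK, -⟩ := convCKWall_holds (Lc := Lc) hLc
  obtain ⟨CT, CT', δT, -, hCT', hδT, -, hT, hTirr⟩ := transport_rows_three_symZ hLc1 hK hδK cE₂ hδin (fun _ => (0 : ℝ))
  -- (F1) the split at `G := fun j ↦ KInvStep Lc j`
  have hsplit : ∀ n : ℕ, (unitS₂ (sfStep Lc n) (smStep 3 Lc n) (T2RecOf 3 Lc (fun j => KInvStep (d := 3) Lc j) (SpureRecAt 3 Lc (toSite r) cE cVH cΛ) (M1At 3 Lc (toSite r) cΛ) cE₂ cB Tc vh₂S (mixFFAt (toSite r) Lc) n)) =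
      transport (fun j => lin4 (cE₂ * (Lc : ℝ) ^ (2 * (3 + 1))) (unitK (sfStep Lc j) (smStep 3 Lc j) (KInvStep (d := 3) Lc j)) Lc) 0 n (unitS₂ (sfStep Lc 0) (smStep 3 Lc 0) (T2RecOf 3 Lc (fun j => KInvStep (d := 3) Lc j) (SpureRecAt 3 Lc (toSite r) cE cVH cΛ) (M1At 3 Lc (toSite r) cΛ) cE₂ cB Tc vh₂S (mixFFAt (toSite r) Lc) 0)) +
        ∑ i ∈ Finset.range n, transport (fun j => lin4 (cE₂ * (Lc : ℝ) ^ (2 * (3 + 1))) (unitK (sfStep Lc j) (smStep 3 Lc j) (KInvStep (d := 3) Lc j)) Lc) (i + 1) (n - 1 - i)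
          (fun κ u κ' u' => (cE₂ * (Lc : ℝ) ^ (2 * (3 + 1))) •
              mmRead Lc (K3OfK (unitK (sfStep Lc i) (smStep 3 Lc i) (KInvStep (d := 3) Lc i)) Lc
              (unitS (sfStep Lc i) (smStep 3 Lc i) (SpureRecAt 3 Lc (toSite r) cE cVH cΛ i)) (unitM (sfStep Lc i) (smStep 3 Lc i) (M1At 3 Lc (toSite r) cΛ i))
              (W2SymOfK (unitK (sfStep Lc i) (smStep 3 Lc i) (KInvStep (d := 3) Lc i)) Lc
                (unitS (sfStep Lc i) (smStep 3 Lc i) (SpureRecAt 3 Lc (toSite r) cE cVH cΛ i)) (unitM (sfStep Lc i) (smStep 3 Lc i) (M1At 3 Lc (toSite r) cΛ i)) 0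
                (unitM₂ (sfStep Lc i) (smStep 3 Lc i) (M2Of 3 Lc (mixFFAt (toSite r) Lc) i))) κ u κ' u') + cB • vh₂S κ u κ' u') := fun n =>
    unitS₂_T2RecOf_eq_transport_add_sum_of_letters (fun j => KInvStep (d := 3) Lc j) (SpureRecAt 3 Lc (toSite r) cE cVH cΛ)
      (M1At 3 Lc (toSite r) cΛ) cE₂ cB Tc hLc1 hBff hBmm (fun j => decays_KInvStep (d := 3) (Lc := Lc) j)
      (fun j => locStencil_SpureRecAt hLc1 hr cE cVH cΛ j) (fun j => ⟨_, 1, one_pos, vertexFamily_M1At hLc1 hr cΛ j zero_le_one⟩)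
      ⟨CB, δB, hδB, hB⟩ (hmix_an1 hLc1 hr) n
  exact ⟨_, δT, hδT, fun n => shape_of_rows (d := 3) (fun n => (unitS₂ (sfStep Lc n) (smStep 3 Lc n) (T2RecOf 3 Lc (fun j => KInvStep (d := 3) Lc j) (SpureRecAt 3 Lc (toSite r) cE cVH cΛ) (M1At 3 Lc (toSite r) cΛ) cE₂ cB Tc vh₂S (mixFFAt (toSite r) Lc) n)))
    (fun i => (fun κ u κ' u' => (cE₂ * (Lc : ℝ) ^ (2 * (3 + 1))) •
              mmRead Lc (K3OfK (unitK (sfStep Lc i) (smStep 3 Lc i) (KInvStep (d := 3) Lc i)) Lc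
              (unitS (sfStep Lc i) (smStep 3 Lc i) (SpureRecAt 3 Lc (toSite r) cE cVH cΛ i)) (unitM (sfStep Lc i) (smStep 3 Lc i) (M1At 3 Lc (toSite r) cΛ i))
              (W2SymOfK (unitK (sfStep Lc i) (smStep 3 Lc i) (KInvStep (d := 3) Lc i)) Lc
                (unitS (sfStep Lc i) (smStep 3 Lc i) (SpureRecAt 3 Lc (toSite r) cE cVH cΛ i)) (unitM (sfStep Lc i) (smStep 3 Lc i) (M1At 3 Lc (toSite r) cΛ i)) 0
                (unitM₂ (sfStep Lc i) (smStep 3 Lc i) (M2Of 3 Lc (mixFFAt (toSite r) Lc) i))) κ u κ' u') + cB • vh₂S κ u κ' u'))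
    (transport (fun j => lin4 (cE₂ * (Lc : ℝ) ^ (2 * (3 + 1))) (unitK (sfStep Lc j) (smStep 3 Lc j) (KInvStep (d := 3) Lc j)) Lc))
    (fun X => (∀ κ u κ' u' t, X κ (u + (Lc : ℤ) • t) κ' (u' + (Lc : ℤ) • t) = shiftK (-((Lc : ℤ) • t)) (X κ u κ' u')) ∧
      (∀ κ κ' κ₁ κ₂, zmode Lc X κ κ' (Sum.inl κ₁) (Sum.inl κ₂) + zmode Lc X κ' κ (Sum.inl κ₁) (Sum.inl κ₂) = 0))
    (fun _ => (0 : ℝ)) hCT' inv_natCast_nonneg (inv_natCast_lt_one hLc) hsplit (hT hpin) (hTirr hpin)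
    (fun m => ⟨(hbrow m).mono (min_le_left _ _), hCb⟩) hZ h0 n⟩

/-! ## §3 At road FP's literal of record -/

/-- NOT IN PRINT; OUR PROOF ATTEMPT — **ROW (U) AT THE LITERAL's DATA**: `ρ_c = toSite (ctrOff (3+1) Lc)`, `(cE, cVH, cΛ, cE₂, cB) = (Lc⁴, −Lc⁸∕2, 2∕Lc⁴, Lc⁸, −Lc¹²∕4)`
(the pin met with equality), `Tc := (8N²)⁻¹ • wsym22 N`, `vh₂S := vh₂SAn1 Lc` (`vh₂SAn1_inl_inl` ∕ `_inr_inr`, K-P's `locStencil₂_vh₂SAn1` at odd `Lc`): from F2a-comb ALONE. -/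
theorem t2Shape_undressedComb_literal_of_F2a (hodd : Odd Lc) (hLc : 2 ≤ Lc) (N : ℕ)
    (hZ : ∀ i : ℕ,
      (∀ κ u κ' u' t,
          (((Lc : ℝ) ^ 8) * (Lc : ℝ) ^ (2 * (3 + 1))) •
              mmRead Lc (K3OfK (unitK (sfStep Lc i) (smStep 3 Lc i) (KInvStep (d := 3) Lc i)) Lc
              (unitS (sfStep Lc i) (smStep 3 Lc i) (SpureRecAt 3 Lc (toSite (ctrOff (3 + 1) Lc)) ((Lc : ℝ) ^ 4) (-((Lc : ℝ) ^ 8 / 2)) (2 / (Lc : ℝ) ^ 4) i)) (unitM (sfStep Lc i) (smStep 3 Lc i) (M1At 3 Lc (toSite (ctrOff (3 + 1) Lc)) (2 / (Lc : ℝ) ^ 4) i))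
              (W2SymOfK (unitK (sfStep Lc i) (smStep 3 Lc i) (KInvStep (d := 3) Lc i)) Lc
                (unitS (sfStep Lc i) (smStep 3 Lc i) (SpureRecAt 3 Lc (toSite (ctrOff (3 + 1) Lc)) ((Lc : ℝ) ^ 4) (-((Lc : ℝ) ^ 8 / 2)) (2 / (Lc : ℝ) ^ 4) i)) (unitM (sfStep Lc i) (smStep 3 Lc i) (M1At 3 Lc (toSite (ctrOff (3 + 1) Lc)) (2 / (Lc : ℝ) ^ 4) i)) 0
                (unitM₂ (sfStep Lc i) (smStep 3 Lc i) (M2Of 3 Lc (mixFFAt (toSite (ctrOff (3 + 1) Lc)) Lc) i))) κ (u + (Lc : ℤ) • t) κ' (u' + (Lc : ℤ) • t)) + (-((Lc : ℝ) ^ 12 / 4)) • vh₂SAn1 Lc κ (u + (Lc : ℤ) • t) κ' (u' + (Lc : ℤ) • t) =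
        shiftK (-((Lc : ℤ) • t)) ((((Lc : ℝ) ^ 8) * (Lc : ℝ) ^ (2 * (3 + 1))) •
              mmRead Lc (K3OfK (unitK (sfStep Lc i) (smStep 3 Lc i) (KInvStep (d := 3) Lc i)) Lc
              (unitS (sfStep Lc i) (smStep 3 Lc i) (SpureRecAt 3 Lc (toSite (ctrOff (3 + 1) Lc)) ((Lc : ℝ) ^ 4) (-((Lc : ℝ) ^ 8 / 2)) (2 / (Lc : ℝ) ^ 4) i)) (unitM (sfStep Lc i) (smStep 3 Lc i) (M1At 3 Lc (toSite (ctrOff (3 + 1) Lc)) (2 / (Lc : ℝ) ^ 4) i))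
              (W2SymOfK (unitK (sfStep Lc i) (smStep 3 Lc i) (KInvStep (d := 3) Lc i)) Lc
                (unitS (sfStep Lc i) (smStep 3 Lc i) (SpureRecAt 3 Lc (toSite (ctrOff (3 + 1) Lc)) ((Lc : ℝ) ^ 4) (-((Lc : ℝ) ^ 8 / 2)) (2 / (Lc : ℝ) ^ 4) i)) (unitM (sfStep Lc i) (smStep 3 Lc i) (M1At 3 Lc (toSite (ctrOff (3 + 1) Lc)) (2 / (Lc : ℝ) ^ 4) i)) 0
                (unitM₂ (sfStep Lc i) (smStep 3 Lc i) (M2Of 3 Lc (mixFFAt (toSite (ctrOff (3 + 1) Lc)) Lc) i))) κ u κ' u') + (-((Lc : ℝ) ^ 12 / 4)) • vh₂SAn1 Lc κ u κ' u')) ∧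
      (∀ κ κ' κ₁ κ₂,
        zmode Lc (fun κ u κ' u' => (((Lc : ℝ) ^ 8) * (Lc : ℝ) ^ (2 * (3 + 1))) •
              mmRead Lc (K3OfK (unitK (sfStep Lc i) (smStep 3 Lc i) (KInvStep (d := 3) Lc i)) Lc
              (unitS (sfStep Lc i) (smStep 3 Lc i) (SpureRecAt 3 Lc (toSite (ctrOff (3 + 1) Lc)) ((Lc : ℝ) ^ 4) (-((Lc : ℝ) ^ 8 / 2)) (2 / (Lc : ℝ) ^ 4) i)) (unitM (sfStep Lc i) (smStep 3 Lc i) (M1At 3 Lc (toSite (ctrOff (3 + 1) Lc)) (2 / (Lc : ℝ) ^ 4) i))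
              (W2SymOfK (unitK (sfStep Lc i) (smStep 3 Lc i) (KInvStep (d := 3) Lc i)) Lc
                (unitS (sfStep Lc i) (smStep 3 Lc i) (SpureRecAt 3 Lc (toSite (ctrOff (3 + 1) Lc)) ((Lc : ℝ) ^ 4) (-((Lc : ℝ) ^ 8 / 2)) (2 / (Lc : ℝ) ^ 4) i)) (unitM (sfStep Lc i) (smStep 3 Lc i) (M1At 3 Lc (toSite (ctrOff (3 + 1) Lc)) (2 / (Lc : ℝ) ^ 4) i)) 0
                (unitM₂ (sfStep Lc i) (smStep 3 Lc i) (M2Of 3 Lc (mixFFAt (toSite (ctrOff (3 + 1) Lc)) Lc) i))) κ u κ' u') + (-((Lc : ℝ) ^ 12 / 4)) • vh₂SAn1 Lc κ u κ' u') κ κ' (Sum.inl κ₁) (Sum.inl κ₂) +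
        zmode Lc (fun κ u κ' u' => (((Lc : ℝ) ^ 8) * (Lc : ℝ) ^ (2 * (3 + 1))) •
              mmRead Lc (K3OfK (unitK (sfStep Lc i) (smStep 3 Lc i) (KInvStep (d := 3) Lc i)) Lc
              (unitS (sfStep Lc i) (smStep 3 Lc i) (SpureRecAt 3 Lc (toSite (ctrOff (3 + 1) Lc)) ((Lc : ℝ) ^ 4) (-((Lc : ℝ) ^ 8 / 2)) (2 / (Lc : ℝ) ^ 4) i)) (unitM (sfStep Lc i) (smStep 3 Lc i) (M1At 3 Lc (toSite (ctrOff (3 + 1) Lc)) (2 / (Lc : ℝ) ^ 4) i))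
              (W2SymOfK (unitK (sfStep Lc i) (smStep 3 Lc i) (KInvStep (d := 3) Lc i)) Lc
                (unitS (sfStep Lc i) (smStep 3 Lc i) (SpureRecAt 3 Lc (toSite (ctrOff (3 + 1) Lc)) ((Lc : ℝ) ^ 4) (-((Lc : ℝ) ^ 8 / 2)) (2 / (Lc : ℝ) ^ 4) i)) (unitM (sfStep Lc i) (smStep 3 Lc i) (M1At 3 Lc (toSite (ctrOff (3 + 1) Lc)) (2 / (Lc : ℝ) ^ 4) i)) 0
                (unitM₂ (sfStep Lc i) (smStep 3 Lc i) (M2Of 3 Lc (mixFFAt (toSite (ctrOff (3 + 1) Lc)) Lc) i))) κ u κ' u') + (-((Lc : ℝ) ^ 12 / 4)) • vh₂SAn1 Lc κ u κ' u') κ' κ (Sum.inl κ₁) (Sum.inl κ₂) = 0))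
    :
    ∃ C₂ δ₂ : ℝ, 0 < δ₂ ∧ ∀ j, LocStencil₂ (unitS₂ (sfStep Lc j) (smStep 3 Lc j) (T2RecOf 3 Lc (fun j => KInvStep (d := 3) Lc j) (SpureRecAt 3 Lc (toSite (ctrOff (3 + 1) Lc)) ((Lc : ℝ) ^ 4) (-((Lc : ℝ) ^ 8 / 2)) (2 / (Lc : ℝ) ^ 4)) (M1At 3 Lc (toSite (ctrOff (3 + 1) Lc)) (2 / (Lc : ℝ) ^ 4)) ((Lc : ℝ) ^ 8) (-((Lc : ℝ) ^ 12 / 4)) ((8 * (N : ℝ) ^ 2)⁻¹ • wsym22 N) (vh₂SAn1 Lc) (mixFFAt (toSite (ctrOff (3 + 1) Lc)) Lc) j)) C₂ δ₂ := by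
  obtain ⟨CB, δB, hδB, hB⟩ := locStencil₂_vh₂SAn1 hodd
  exact t2Shape_undressedComb_three_of_F2a hLc (ctrOff_mem_box (by omega)) (cE := (Lc : ℝ) ^ 4) (by norm_num) _ _ _ _ _
    (fun κ u κ' u' x z α β => vh₂SAn1_inl_inl κ u κ' u' x z α β) (fun κ u κ' u' x z μ ν => vh₂SAn1_inr_inr κ u κ' u' x z μ ν)
    hB hδB (by rw [abs_of_nonneg (by positivity)]) hZ

end Three

end Summit.QuantumFields.BalabanUV.Beta.GAN24.T2UndressedCombShapeEnd

end
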